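import Literature.NumberTheory.EllipticCurves.ModularCurve
import HarnessLib
import HarnessLib.Audit.Tags

/-!
# Candidate E-desc-1 of cell `bsd-f2-manin` (D-0131 (3) frontier: the Manin constant at additive
# primes): an ABSOLUTE bound on `ord_p(c_E)` — Pasten 2024 Thm. 10.1 with the finite set `S` of
# bad primes deleted. A `@[conjecture]` leaf (NOTHING asserted; this module contains only the
# definition, so that files assuming it may import it; the proved placement edges are in the
# sibling `AbsoluteManinValuationBoundEdges.lean`).

HONEST FRAMING. LENS = descent / visibility (planner `bsd-f2-manin-desc`, HOME
`run/shared/lean/pub/bsd-f2-manin/MEMO-desc.md` §2, Sketch.lean sha16 a03e6549cfc5163d). Informal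
law: «for every prime `p` there is `μ_p` such that every `X₀(N)`-optimal elliptic curve `E/ℚ`
has `ord_p(c_E) ≤ μ_p`» — uniform in the curve AND in the set of additive primes. NOT in print:
Pasten, *Shimura curves and the abc conjecture*, J. Number Theory 254 (2024), Thm. 10.1 (tree fact
`Literature.NumberTheory.EllipticCurves.ModularForms.PastenShimura2024_thm_10_1`,
`ManinConstantValuationBound.lean`) gives `μ_{S,p}` for optimal curves semistable OUTSIDE a
finite set `S`; Edixhoven's curve-independent bounds at `2, 3, 5, 7` are asserted only in the
unpublished thesis [Edi89] (Agashe–Ribet–Stein 2006 p. 619; refuter-2 placement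
`ref2/LIT-PLACEMENT-MANIN-ADDITIVE-v1.md` §B8: OPEN). At `p ≥ 11` the statement is Edixhoven
1991 Thm. 3 with `μ_p = 1` (tree fact `edixhoven_padicValInt_maninConstant_le_one`; edge in the
sibling file), so its content is `p ∈ {2, 3, 5, 7}`. Proposed mechanism (memo §2, not a proof):
in Pasten's proof of Thm. 10.1 the set `S` enters only through Lemma 10.5 ← Lemma 6.7
(Eisenstein-congruence depth via Shafarevich over `S`); Katz 1981 (Lang's question for elliptic
curves) + Mazur 1977 / Kubert 1976 torsion bounds give an absolute depth (support candidate K2).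
BC5 WITNESS (weakness / population): table `MANIN-ADDITIVE-CREMONA-TIER-v1.tsv.gz` sha16
6845c1f1d5e22f91 (984 410 classes, `c_E ≡ 1` certified by Cremona, so `ord_p(c_E) = 0` throughout
— refuter-1 trap T4: no table can violate an upper bound); filter `p² ∣ N`: meets / beyond the
ČNS degree road (`p ∣ deg φ₀` or `ε_p = 1`) / violations = `p = 2`: 867 211 / 867 153 / 0;
`p = 3`: 374 108 / 354 146 / 0; `p = 5`: 147 040 / 83 726 / 0; `p = 7`: 80 834 / 35 260 / 0.
Cheapest falsifier: none by data (∃ μ); the refutable content is the mechanism (K1/K2, by proof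
reading). «Why novel»: PS24 is per-`S`; the Katz81+Mazur77 replacement of PS24 Lemma 6.7 is in
neither PS24 nor the 58 corpus/galaxy hits of ref2 §D. Beyond-print theorem candidate: YES.
Refuter verdicts: REF1 **SURVIVES** (2026-08-27T13:19Z, HOME/REFUTER-ref1.md §R1.1: rc 0; = PS24 10.1 − S
verbatim; MC ⇒ A ⇒ PS24 re-proved independently; lattice clause + minimality load-bearing; unviolable by
data; content = p ∈ {2,3,5,7}; BC7 crux probe CLEAN; K1 unverified = a prover's first check);
REF2 pre-placement: OPEN (ref2/LIT-PLACEMENT-MANIN-ADDITIVE-v1.md §B8). Row E-desc-1 of HOME/CANDIDATES.md.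

RENDERING: VERBATIM the tree fact `PastenShimura2024_thm_10_1` with the binder
`(∀ q : ℕ, q.Prime → q ∉ S → ¬ q ^ 2 ∣ N')` (and `S`) deleted; the free level `N'` is kept on
purpose to mirror the typed fact (refuter-1 trap T3 is harmless: no `v_p(N')` is read); the
optimality of `φ_{D'}` is the LATTICE CLAUSE `Λ_{W'} = c·Λ_f` on a globally minimal `W'` (traps
T1/T2 satisfied), so `|D'.maninConstant| = c_E`.
-/

noncomputable section

open scoped MatrixGroups ModularForm

open CongruenceSubgroup WeierstrassCurve
  Literature.NumberTheory.EllipticCurves.ModularForms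

namespace Summit.BirchSwinnertonDyer.Rank1Residual.ManinAdditive

/-- **Candidate E-desc-1 `AbsoluteManinValuationBound` (cell bsd-f2-manin; OPEN, NOT in print,
nothing asserted):** for every prime `p` there is `μ : ℕ` such that for every globally minimal
elliptic `W'/ℚ`, every level `N'` and every `X₀(N')`-parametrisation datum `D'` of `W'` satisfying
the lattice clause `Λ_{W'} = c·Λ_f` (`φ_{D'}` optimal, `|D'.c| = c_E`), `padicValInt p D'.maninConstant ≤ μ`.
= `PastenShimura2024_thm_10_1` with the "semistable outside `S`" binder deleted (Pasten 2024
Thm. 10.1, p. 33: "There is a constant `μ_{S,p}` depending only on `S` and `p` …" — here `μ_p`).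
Edges (sibling file): `ManinConstantOne → this → PastenShimura2024_thm_10_1`; at `p > 7` implied by
`edixhoven_padicValInt_maninConstant_le_one` with `μ = 1`.
[cite: PastenShimura2024, Thm. 10.1 p. 33 (shape only: the printed theorem carries the finite set S; the S-free statement is NOT in print — cell bsd-f2-manin MEMO-desc.md §2)] -/
@[conjecture] def AbsoluteManinValuationBound : Prop :=
  ∀ (p : ℕ), p.Prime → ∃ μ : ℕ,
    ∀ (W' : WeierstrassCurve ℚ) [W'.IsElliptic] [W'.IsGloballyMinimal] {N' : ℕ} [NeZero N']
      (D' : ModularParametrizationData W' N'),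
      (∀ z ∈ D'.L.lattice, ∃ w ∈ periodLattice D'.f, z = D'.c * w) →
      padicValInt p D'.maninConstant ≤ μ

end Summit.BirchSwinnertonDyer.Rank1Residual.ManinAdditive

end
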